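import Summits.BirchSwinnertonDyer.Rank1Residual.Supersingular.X6VisibilityTamDefectL1CertLocTorRecords
import Summits.BirchSwinnertonDyer.Rank1Residual.Supersingular.X6RankZeroLeafTarget
import HarnessLib

/-!
# Leaf `ClassX6 ∧ r_an = 0` (A6): the T3 WITNESS of route `PrintX6` — the Eisenstein half `ord_5 #Ш_an ≤ ord_5 #Ш(E/ℚ)` AT THE CELL
# `(22678e1, p = 5)`, by name from the landed visibility closure, in a module OUTSIDE the route file's importers
# (cell `bsd-print-x6`, seat p4 gen 1; PLAN v2 task (W); `--supports` crux `EisensteinHalfFiveLe`, closes no item)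

PARTITION currency (D-0054): leaf A6 = X6 ∧ r_an = 0; ONE cell; nothing booked here (the cell `(22678e1, 5)` is PROVED-by-name of
record since referee A R318 through `bsdp_x6r0visblt_22678e1_5`'s ancestor p388388); BEYOND-PRINT THEOREM: **NO**.

WHY THIS FILE. The tribunal fit of route `PrintX6` (D-0033; planner gen 1, PLAN v2) persists a WITNESS decl for the attacked crux
`EisensteinHalfFiveLe` (E₅: ∀ X6 ∧ ¬CM ∧ r_an = 0 pairs with p ≥ 5, ∀ q = #Ш_an with ord_p q ≠ 0, ord_p q ≤ ord_p #Ш(E/ℚ)) — a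
kernel theorem exhibiting E₅'s conclusion at ONE inhabited non-unit cell, living in the route file's IMPORT CLOSURE. Every
`Theorems/PrintX6*` module imports the route file and can therefore never be imported by it (cycle; bsd-eis precedent
t3:witness-error); this module imports only b2b-bsdres' visibility records and ty2's leaf interface. The cell: `E = 22678e1`
(Cremona; `[1, 0, 0, 3140254662, −139987982322460]`, N = 22678 = 2·17·23·29 square-free, good supersingular at 5 with a₅ = 0,
ord₅ #Ш_an = 2, ord₅ ∏c = 2 — the A6 census cell of record at p ≥ 5, referee A R303/R318), closed per pair by Cremona–Mazur
VISIBILITY: the 5-congruent partner `F = 430882i1` of rank 2 makes `(ℤ/5)² ↪ Ш(E)[5]`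
visible in `E × F`, Cassels–Tate squares it, Wuthrich 2014 Prop. 21 bounds it above (`bsdp_x6r0visblt_22678e1_5`,
`X6VisibilityTamDefectL1CertLocTorRecords.lean`: every local binder discharged in the kernel; remaining binders = the named facts
`hCT`, `hW`, `hGZK`, `hmod`, `hϖ`, `hU`, `hU2`, `hF44`, `hF13`, the newform `f`/`hf` and the engine's level-one ENCLOSURE `hball0` of
`3·L(E,1)/ω₁ = 1250` (kit j202394; second engine j256108, R318)).

WHAT IS PROVED. `X6RankZero.eisensteinHalfFiveLe_cell_22678e1_at5`: under exactly those binders, `∀ q : ℚ, #Ш(E)_an = q → ord_5 q ≠ 0 →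
ord_5 q ≤ ord_5 #Ш(E/ℚ)` — E₅'s conclusion at the cell, verbatim in the route's currency. Chain: `BSD(E,5)` (the visibility theorem)
⇒ `MissingLowerBoundAt W 5` (`X6RankZero.missingLowerBoundAt_of_bsdp`, needs `r_an = 0`, read off the enclosure: `L(E,1) = 0` would
put `|mid| ≤ 10⁻²⁰` against `|mid − 1250| ≤ 10⁻²⁰`) ⇒ the inequality at every rational value of `#Ш_an`
(`padicValRat_le_of_missingLowerBoundAt`). Also the hW-free reading is NOT available by name today (the visibility chain threads
Wuthrich's bound through every layer); Prop. 21 is PRINT tier (cell referee R-0.8, PA-3).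

References: Cremona–Mazur 2000 §3 [CremonaMazur2000]; Fisher 2016 Thm 4.4 [Fisher2016Visualizing7]; Fisher 2012 Thm 13.2
[Fisher2012Hessian]; Wuthrich 2014 Prop. 21 [Wuthrich2014]; Cassels 1962 [Cassels1962ArithmeticIV]; Miller 2011 Def 1.1
[Miller2011LMS]; HOME/PLAN.md v2 (W).
-/

set_option autoImplicit false

noncomputable section

open scoped Classical MatrixGroups ModularForm

open CongruenceSubgroup WeierstrassCurve Literature.NumberTheory.EllipticCurves
  Literature.NumberTheory.EllipticCurves.Rank1Residual
  Literature.NumberTheory.EllipticCurves.Rank1Residual.Typed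
  Literature.NumberTheory.EllipticCurves.Rank1Residual.X11RankOneCertificates
  Literature.NumberTheory.EllipticCurves.Wuthrich2014
  Literature.NumberTheory.EllipticCurves.Fisher2016
  Literature.NumberTheory.EllipticCurves.Fisher2012
  Literature.NumberTheory.EllipticCurves.ModularForms

namespace Summit.BirchSwinnertonDyer.Rank1Residual.Supersingular

/-- **T3 witness of route `PrintX6`: the Eisenstein half of `BSD(E,5)` AT THE CELL `(22678e1, 5)`.** Under the binders of the
landed visibility closure `bsdp_x6r0visblt_22678e1_5` — Cassels–Tate `hCT`, Wuthrich 2014 Prop. 21 `hW`, GZK `hGZK`, modularity `hmod`,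
the period comparison `hϖ`, Tate uniformisation `hU`/`hU2`, Fisher's Thm 4.4 `hF44` and Thm 13.2 `hF13`, the models of `E = 22678e1` and
of its rank-2 `5`-congruent partner `F = 430882i1`, the newform `f` of `E`, and the engine's level-one enclosure `hball0` of
`3·L(E,1)/ω₁ = 1250` — for every rational `q` with `#Ш(E)_an = q` (and `ord_5 q ≠ 0`, unused): `ord_5 q ≤ ord_5 #Ш(E/ℚ)`. This is the
conclusion of crux `EisensteinHalfFiveLe` at one inhabited non-unit cell (`ord_5 #Ш_an = 2`). Proof: the visibility theorem gives
`BSD(E,5)`; `r_an = 0` from the enclosure (`L(E,1) = 0` contradicts `|mid − 1250| ≤ 10⁻²⁰ ∧ |0 − mid| ≤ 10⁻²⁰`) and modularity;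
then `X6RankZero.missingLowerBoundAt_of_bsdp` and `padicValRat_le_of_missingLowerBoundAt`. Per pair; not a class theorem.
[cite: CremonaMazur2000, §3] [cite: Fisher2016Visualizing7, Thm. 4.4] [cite: Wuthrich2014, Prop. 21 (p. 400)]
[cite: SilvermanAEC2009, Thm. X.4.14] [cite: Miller2011LMS, Def. 1.1] -/
theorem X6RankZero.eisensteinHalfFiveLe_cell_22678e1_at5
    (hCT : exists_casselsTate_pairing (K := ℚ)) (hW : sha_dvd_analyticSha)
    (hGZK : rank_eq_analyticRank_of_analyticRank_le_one) (hmod : hasEntireLFunction_rat)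
    (hϖ : realPeriodRat_eq_unit_mul_plusPeriod)
    (hU : Silverman1994_thmV53_tateUniformisation.{0})
    (hU2 : Silverman1994_thmV53_corV54_tateUniformisation.{0})
    (hF44 : thm44_selmerLocalKer_iff_of_nonsplit_good) (hF13 : thm132_fiveCongruent_hessePencil)
    {W F : WeierstrassCurve ℚ} [W.IsElliptic] [W.IsGloballyMinimal] [F.IsElliptic] [F.IsGloballyMinimal]
    (hWeq : W = ⟨1, 0, 0, 3140254662, -139987982322460⟩) (hFeq : F = ⟨1, 0, 0, -14128, -645920⟩)
    {N : ℕ} [NeZero N] (f : CuspForm (Gamma0 N) 2) (hf : IsNewformOf W f)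
    (hball0 : ∃ mid rad : ℝ, rad ≤ 1 / 10 ^ (20 : ℕ) ∧ |mid - ((1250 : ℤ) : ℝ)| ≤ 1 / 10 ^ (20 : ℕ) ∧
      |((3 : ℕ) : ℝ) * (((1 : ℕ) : ℝ) * ((W.entireLFunction 1).re / plusPeriod f)) - mid| ≤ rad) :
    ∀ q : ℚ, shaAn W = (q : ℂ) → padicValRat 5 q ≠ 0 → padicValRat 5 q ≤ (padicValNat 5 W.shaOrder : ℤ) := by
  haveI : Fact (Nat.Prime 5) := ⟨by norm_num⟩
  have hbsd : BSDp W 5 :=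
    bsdp_x6r0visblt_22678e1_5 hCT hW hGZK hmod hϖ hU hU2 hF44 hF13 hWeq hFeq f hf hball0
  -- `r_an = 0` from the enclosure: `L(E,1) ≠ 0`
  have hL : W.entireLFunction 1 ≠ 0 := by
    obtain ⟨mid, rad, hrad, hmid, hball⟩ := hball0
    intro hL0
    rw [hL0] at hball
    simp only [Complex.zero_re, zero_div, mul_zero, zero_sub, abs_neg] at hball
    rw [abs_le] at hmid hball
    norm_num at hmid hball hrad
    linarith [hmid.1, hball.2]
  have hr0 : W.analyticRank = 0 := (W.analyticRank_eq_zero_iff_holds (hmod W)).2 hL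
  intro q hq _
  exact padicValRat_le_of_missingLowerBoundAt W 5 (X6RankZero.missingLowerBoundAt_of_bsdp W 5 hGZK hr0 hbsd) q hq

end Summit.BirchSwinnertonDyer.Rank1Residual.Supersingular

end
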